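import Mathlib
import HarnessLib
import Summits.Ventures.LatticeQCDFlow.Scoring.SplitChainTourMoments

/-!
# Tours of the split chain, VI: later tours after a regeneration, and the CEMENTED path — a
# function of the past up to time `t` that leaves every finished tour unchanged

HONEST FRAMING: exact (Metropolis-corrected) sampling algorithms for lattice gauge theory;
figures of merit are autocorrelation/cost numbers at stated couplings and volumes; no
continuum-physics claim.

Venture `LatticeQCDFlow` (cell pub-lqcd), topic `Scoring`; FANOUT row 8 (`s0-cpn-nemc`, GEN-16).
NEW WORK of the cell, not a published result; no definition is introduced.  Notation of
`Scoring/SplitChainTours.lean`.  Two pathwise tools for conditioning on "everything before the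
`(j+1)`-th regeneration" in the tour theorem (`Scoring/SplitChainTourTheorem.lean`), whose past
weights must be functionals `G_t` with `DependsOn (G t) (Set.Iic t)`: (i) TRANSPORT OF LATER TOURS —
at the start `t + 1` of tour `j + 1`, tour `j + 1 + i` of the path is tour `i` of the shifted path,
for every `i`; (ii) the CEMENTED PATH `n ↦ if n ≤ t then x̂_n else ((x̂_t).1, heads)` — it is a
measurable function of `x̂_0, …, x̂_t` only (so ANY functional of it is an admissible past weight),
and when `K_t(x̂) = j` and `coin_{t+1}` heads it has the same head counts up to `t`, a head at `t + 1`,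
and hence the same tour sums and tour lengths for every tour `i ≤ j` as `x̂` itself.  This is how a
functional of the tours `≤ j` (which looks at the whole path through `∑'`) is certified to depend
only on the past at the regeneration time.  Nothing is cited; no printed counterpart beyond the
parent files.

## Content

* **`tourSum_transport_add`** — `K_t = j`, `coin_{t+1}` heads ⇒ `S^ψ_{j+1+i}(x̂) = S^ψ_i(θ_{t+1} x̂)`;
* `headCount_cement`, **`tourSum_cement`**, `tourLength_cement` — the cemented path has the head
  counts of `x̂` up to `t` and, if `K_t(x̂) = j` and `coin_{t+1}` heads, the same `S^g_i`, `N_i` for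
  `i ≤ j`;
* **`dependsOn_comp_cement`** — `Φ ∘ cement_t` depends only on `Set.Iic t`, for every `Φ`;
  `measurable_cement`.

NOT CLAIMED: anything probabilistic (see `Scoring/RegenerativeMedianOfGroups.lean`).
-/

noncomputable section

namespace Summit.Ventures.LatticeQCDFlow.Scoring

open MeasureTheory ProbabilityTheory Filter Finset Preorder Literature.Probability.MarkovChains
open scoped ENNReal

/-! ### Pathwise: later tours after a regeneration; the cemented path -/

section Pathwise

variable {Ω : Type*}

/-- **Transport of later tours**: if `K_t = j` and `coin_{t+1}` heads, then for every `i`,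
`S^ψ_{j+1+i}(x̂) = S^ψ_i(θ_{t+1} x̂)`. -/
theorem tourSum_transport_add (ψ : Ω × Bool → Ω × Bool → ℝ) (x : ℕ → Ω × Bool) {j t : ℕ}
    (ht : (∑ s ∈ Finset.range t, (if (x (s + 1)).2 then (1 : ℕ) else 0)) = j)
    (hh : (x (t + 1)).2 = true) (i : ℕ) :
    ∑' u, (if (∑ s ∈ Finset.range u, (if (x (s + 1)).2 then (1 : ℕ) else 0)) = j + 1 + i
        then (1 : ℝ) else 0) * ψ (x u) (x (u + 1))
      = ∑' n, (if (∑ s ∈ Finset.range n, (if (x (t + 1 + (s + 1))).2 then (1 : ℕ) else 0)) = i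
        then (1 : ℝ) else 0) * ψ (x (t + 1 + n)) (x (t + 1 + (n + 1))) := by
  symm
  have hinj : Function.Injective (fun n : ℕ => t + 1 + n) := fun a b h => by simpa using h
  rw [← hinj.tsum_eq (f := fun u => (if (∑ s ∈ Finset.range u,
      (if (x (s + 1)).2 then (1 : ℕ) else 0)) = j + 1 + i then (1 : ℝ) else 0) * ψ (x u) (x (u + 1)))]
  · refine tsum_congr fun n => ?_
    have hK : (∑ s ∈ Finset.range (t + 1 + n), (if (x (s + 1)).2 then (1 : ℕ) else 0))
        = j + 1 + ∑ s ∈ Finset.range n, (if (x (t + 1 + (s + 1))).2 then (1 : ℕ) else 0) := by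
      rw [headCount_add, ht, hh]; rfl
    simp only [hK, Nat.add_left_cancel_iff]
    rfl
  · intro u hu
    rw [Function.mem_support] at hu
    have hK : (∑ s ∈ Finset.range u, (if (x (s + 1)).2 then (1 : ℕ) else 0)) = j + 1 + i := by
      by_contra h; exact hu (by rw [if_neg h, zero_mul])
    have htu : t + 1 ≤ u := by
      by_contra h
      have := headCount_mono x (show u ≤ t by omega)
      omega
    exact ⟨u - (t + 1), by show t + 1 + (u - (t + 1)) = u; omega⟩

/-- The head count of the cemented path agrees with that of `x̂` up to time `t`. -/
theorem headCount_cement (x : ℕ → Ω × Bool) (t : ℕ) {u : ℕ} (hu : u ≤ t) :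
    (∑ s ∈ Finset.range u, (if (if s + 1 ≤ t then x (s + 1) else ((x t).1, true)).2
        then (1 : ℕ) else 0))
      = ∑ s ∈ Finset.range u, (if (x (s + 1)).2 then (1 : ℕ) else 0) :=
  Finset.sum_congr rfl fun s hs => by
    have : s + 1 ≤ t := by have := Finset.mem_range.1 hs; omega
    simp only [this, if_true]

/-- **Cementing does not change finished tours**: if `K_t = j`, `coin_{t+1}` heads and `i ≤ j`,
the tour sum `S^g_i` (of a function of the state) of the cemented path equals that of `x̂`. -/
theorem tourSum_cement (g : Ω → ℝ) (x : ℕ → Ω × Bool) {i j t : ℕ} (hij : i ≤ j)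
    (ht : (∑ s ∈ Finset.range t, (if (x (s + 1)).2 then (1 : ℕ) else 0)) = j)
    (hh : (x (t + 1)).2 = true) :
    ∑' u, (if (∑ s ∈ Finset.range u,
        (if (if s + 1 ≤ t then x (s + 1) else ((x t).1, true)).2 then (1 : ℕ) else 0)) = i
        then (1 : ℝ) else 0) * g (if u ≤ t then x u else ((x t).1, true)).1
      = ∑' u, (if (∑ s ∈ Finset.range u, (if (x (s + 1)).2 then (1 : ℕ) else 0)) = i
        then (1 : ℝ) else 0) * g (x u).1 := by
  have hyt : (∑ s ∈ Finset.range t, (if ((fun n : ℕ => if n ≤ t then x n else ((x t).1, true))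
      (s + 1)).2 then (1 : ℕ) else 0)) = j := by
    show (∑ s ∈ Finset.range t, (if (if s + 1 ≤ t then x (s + 1) else ((x t).1, true)).2
      then (1 : ℕ) else 0)) = j
    rw [headCount_cement x t le_rfl, ht]
  have hyh : ((fun n : ℕ => if n ≤ t then x n else ((x t).1, true)) (t + 1)).2 = true := by
    show (if t + 1 ≤ t then x (t + 1) else ((x t).1, true)).2 = true
    rw [if_neg (by omega)]
  have h1 := tourSum_eq_finsetSum (fun p _ => g p.1) (fun n : ℕ => if n ≤ t then x n else
    ((x t).1, true)) hij hyt hyh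
  have h2 := tourSum_eq_finsetSum (fun p _ => g p.1) x hij ht hh
  refine (h1.trans ?_).trans h2.symm
  refine Finset.sum_congr rfl fun u hu => ?_
  have hut : u ≤ t := by have := Finset.mem_range.1 hu; omega
  show (if (∑ s ∈ Finset.range u, (if (if s + 1 ≤ t then x (s + 1) else ((x t).1, true)).2
      then (1 : ℕ) else 0)) = i then (1 : ℝ) else 0) * g (if u ≤ t then x u else ((x t).1, true)).1
    = (if (∑ s ∈ Finset.range u, (if (x (s + 1)).2 then (1 : ℕ) else 0)) = i
      then (1 : ℝ) else 0) * g (x u).1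
  rw [headCount_cement x t hut, if_pos hut]

/-- Any functional of the cemented path depends only on times `≤ t`. -/
theorem dependsOn_comp_cement {β : Type*} (Φ : (ℕ → Ω × Bool) → β) (t : ℕ) :
    DependsOn (fun x : ℕ → Ω × Bool => Φ (fun n : ℕ => if n ≤ t then x n else ((x t).1, true)))
      (Set.Iic t) := by
  intro x y hxy
  show Φ _ = Φ _
  congr 1
  funext n
  by_cases hn : n ≤ t
  · simp only [hn, if_true]; exact hxy n (Set.mem_Iic.2 hn)
  · simp only [hn, if_false]; rw [hxy t (Set.mem_Iic.2 le_rfl)]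

/-- **Cementing does not change finished tour lengths** (the case `g = 1` of `tourSum_cement`). -/
theorem tourLength_cement (x : ℕ → Ω × Bool) {i j t : ℕ} (hij : i ≤ j)
    (ht : (∑ s ∈ Finset.range t, (if (x (s + 1)).2 then (1 : ℕ) else 0)) = j)
    (hh : (x (t + 1)).2 = true) :
    ∑' u, (if (∑ s ∈ Finset.range u,
        (if (if s + 1 ≤ t then x (s + 1) else ((x t).1, true)).2 then (1 : ℕ) else 0)) = i
        then (1 : ℝ) else 0)
      = ∑' u, (if (∑ s ∈ Finset.range u, (if (x (s + 1)).2 then (1 : ℕ) else 0)) = i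
        then (1 : ℝ) else 0) := by
  have h := tourSum_cement (fun _ => (1 : ℝ)) x hij ht hh
  simp only [mul_one] at h
  exact h

end Pathwise

/-! ### The cemented path is a measurable function of the past -/

section Cement

variable {Ω : Type*} [MeasurableSpace Ω]

/-- Cementing at time `t` is measurable. -/
theorem measurable_cement (t : ℕ) :
    Measurable fun (x : ℕ → Ω × Bool) (n : ℕ) => if n ≤ t then x n else ((x t).1, true) := by
  refine measurable_pi_lambda _ fun n => ?_
  by_cases hn : n ≤ t
  · simp only [hn, if_true]; exact measurable_pi_apply n
  · simp only [hn, if_false]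
    exact (measurable_fst.comp (measurable_pi_apply t)).prodMk measurable_const

end Cement

end Summit.Ventures.LatticeQCDFlow.Scoring

end
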